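import Literature.AlgebraicGeometry.Morphisms.SectionsRankOfFibreVanishing
import HarnessLib

/-!
# Over an INTEGRAL base, `h⁰` of a fibre with `H¹ = 0` is the generic rank of `Γ(X, G)` — hence the same at all such fibres
# (Hartshorne III Thm. 9.9 / Cor. 12.9; Mumford, *Abelian Varieties* §5 Cor. 2–3)

Layer `Literature/AlgebraicGeometry/Morphisms`, namespace `Literature.AlgebraicGeometry.Morphisms`.  Theorems only; no definition,
no named fact, no instance.  Sequel of ★ `Morphisms/SectionsRankOfFibreVanishing` (the local step at a prime).

For `f : X → Spec A` proper flat with `A` a Noetherian DOMAIN, `G` finite locally free, `K = Frac A`, and a fibre square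
`X_𝔭 = X ×_A κ(𝔭)` at a prime `𝔭` with `Ext¹(𝒪_{X_𝔭}, G|_{X_𝔭}) = 0` («`H¹(X_𝔭, G_𝔭) = 0`»):

* **`finrank_secMod_fibre_eq_finrank_tensor_fractionRing`** — `h⁰(X_𝔭, G|_{X_𝔭}) = dim_K (K ⊗_A Γ(X, G))`, the GENERIC RANK of
  `Γ(X, G)` (in the tree's currency: `Γ(Spec K, 𝒪) ⊗_{Γ(Spec A, 𝒪)} Γ(X, G)`): by ★ `finite_and_projective_tensor_secMod_top_atPrime` and ★
  `finrank_tensor_secMod_top_atPrime` the `Γ(Spec A_𝔭, 𝒪)`-module `Γ(Spec A_𝔭, 𝒪) ⊗ Γ(X, G)` is finite FREE of rank `h⁰(X_𝔭, G_𝔭)`, and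
  a free module keeps its rank under the further base change `A_𝔭 → K` (Mathlib `Module.finrank_baseChange`, `cancelBaseChange`);
* **`finrank_secMod_fibre_eq_of_subsingleton_ext`** — hence ANY TWO such fibres have the same `h⁰`: Hartshorne III Thm. 9.9 «the Hilbert
  polynomial is independent of `t`» in the form the Hilbert-scheme road consumes (F-5 (5b) §3 (γ): on an INTEGRAL flat stratum all
  fibres `Z_y` have the same `h⁰(Z_y, 𝒪(m))` as soon as `H¹(Z_y, 𝒪(m)) = 0`, so the same Hilbert polynomial);
* **`finrank_secMod_fibre_eq_finrank_secMod_genericFibre`** — and `h⁰(X_𝔭, G_𝔭) = h⁰(X_K, G_K)` for ANY cartesian square over the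
  generic point `Spec K → Spec A` (no vanishing needed there: flat base change, ★ `Modules.exists_tensor_secMod_top_linearEquiv_of_flat`).

Scalars are the rings `Γ(Spec κ(𝔭), 𝒪)`, `Γ(Spec K, 𝒪)` of the (h2) chain (★ `SectionsRankOfFibreVanishing`, ★ B-p19
`ProjectiveFamilyTwistPushforward`).  Universe `Scheme.{0}` (that of the module Čech dialect).  Cell hodgecm-mathlib, F-5 (5b) §3 (γ)
engine (B-p09 (g15)); the Hilbert-polynomial corollary over the fibre dictionary L-a is the next file.  HC_CM is proved only modulo the
7 printed citations until rung 0 closes; this file discharges none of them.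

## References

* R. Hartshorne, *Algebraic Geometry*, GTM 52 (1977), III Thm. 9.9 (p. 261), III Thm. 12.11 (p. 290), Cor. 12.9 (p. 288). [Hartshorne1977]
* D. Mumford, *Abelian Varieties*, TIFR Studies in Mathematics 5 (1970), §5, Cor. 2 (p. 50), Cor. 3 (p. 53). [MumfordAV1970]
* The Stacks Project, Tag 02KH (flat base change). [StacksProject]
-/

noncomputable section

set_option backward.isDefEq.respectTransparency false

open CategoryTheory CategoryTheory.Limits CategoryTheory.Abelian Opposite TopologicalSpace AlgebraicGeometry TensorProduct
open Literature.Algebra.Homology Literature.Algebra.Module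

namespace Literature.AlgebraicGeometry.Morphisms

open Literature.AlgebraicGeometry.Modules Literature.AlgebraicGeometry.HodgeTheory Literature.AlgebraicGeometry.Motives

section GenericRank

variable {A : Type} [CommRing A] [IsDomain A] [IsNoetherianRing A] {X : Scheme.{0}}
  (f : X ⟶ Spec (CommRingCat.of A)) [IsProper f] [Flat f] (G : X.Modules)

omit [IsNoetherianRing A] in
/-- Elements of the complement of a prime of a domain become units in the fraction field. [folklore] -/
private theorem isUnit_algebraMap_fractionRing_of_mem_primeCompl (𝔭 : Ideal A) [𝔭.IsPrime] (y : 𝔭.primeCompl) :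
    IsUnit (algebraMap A (FractionRing A) y) := by
  have hy : (y : A) ≠ 0 := fun h => y.2 (h ▸ 𝔭.zero_mem)
  exact IsUnit.mk0 _ ((map_ne_zero_iff _ (IsFractionRing.injective A (FractionRing A))).mpr hy)

/-- **`h⁰(X_𝔭, G_𝔭)` is the generic rank of `Γ(X, G)`** (Hartshorne III Thm. 9.9, proof; Cor. 12.9): for `f : X → Spec A` proper flat
over a Noetherian DOMAIN, `G` finite locally free and a fibre square at a prime `𝔭` with `Ext¹(𝒪_{X_𝔭}, G|_{X_𝔭}) = 0`,
`dim_{κ(𝔭)} Γ(X_𝔭, G|_{X_𝔭}) = dim_K (K ⊗_A Γ(X, G))`, `K = Frac A` — both are the rank of the finite FREE `A_𝔭`-module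
`A_𝔭 ⊗_A Γ(X, G)` (★ `finrank_tensor_secMod_top_atPrime`, ★ `finite_and_projective_tensor_secMod_top_atPrime`; a free module keeps
its rank under `A_𝔭 → K`). [cite: Hartshorne1977, III Thm. 9.9 (p. 261)] [cite: Hartshorne1977, III Thm. 12.11 (p. 290), Cor. 12.9]
[cite: MumfordAV1970, §5 Cor. 2 (p. 50)] -/
theorem finrank_secMod_fibre_eq_finrank_tensor_fractionRing (hL : IsFiniteLocallyFree G) (𝔭 : Ideal A) [𝔭.IsPrime]
    {X₀ : Scheme.{0}} {iX : X₀ ⟶ X} {f₀ : X₀ ⟶ Spec (CommRingCat.of 𝔭.ResidueField)}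
    (HX : IsPullback iX f₀ f (Spec.map (CommRingCat.ofHom (algebraMap A 𝔭.ResidueField))))
    (hvan : Subsingleton (Ext.{1} (unitModule X₀) ((Scheme.Modules.pullback iX).obj G) 1)) :
    letI := ((Spec.map (CommRingCat.ofHom (algebraMap A (FractionRing A)))).appLE ⊤ ⊤ le_top).hom.toAlgebra
    Module.finrank Γ(Spec (CommRingCat.of 𝔭.ResidueField), ⊤) (SecMod ((Scheme.Modules.pullback iX).obj G) f₀.appTop.hom ⊤) =
      Module.finrank Γ(Spec (CommRingCat.of (FractionRing A)), ⊤)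
        (Γ(Spec (CommRingCat.of (FractionRing A)), ⊤) ⊗[Γ(Spec (CommRingCat.of A), ⊤)] SecMod G f.appTop.hom ⊤) := by
  -- the three rings `R = Γ(Spec A)`, `Rp = Γ(Spec A_𝔭)`, `RK = Γ(Spec K)` and their algebra structures
  let Ap : Type := Localization.AtPrime 𝔭
  let K : Type := FractionRing A
  let jl : Spec (CommRingCat.of Ap) ⟶ Spec (CommRingCat.of A) := Spec.map (CommRingCat.ofHom (algebraMap A Ap))
  let jK : Spec (CommRingCat.of K) ⟶ Spec (CommRingCat.of A) := Spec.map (CommRingCat.ofHom (algebraMap A K))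
  let ψ : Ap →+* K := IsLocalization.lift (M := 𝔭.primeCompl) (isUnit_algebraMap_fractionRing_of_mem_primeCompl 𝔭)
  have hψ : ∀ a : A, ψ (algebraMap A Ap a) = algebraMap A K a := fun a =>
    IsLocalization.lift_eq (M := 𝔭.primeCompl) (isUnit_algebraMap_fractionRing_of_mem_primeCompl 𝔭) a
  let jψ : Spec (CommRingCat.of K) ⟶ Spec (CommRingCat.of Ap) := Spec.map (CommRingCat.ofHom ψ)
  letI algL : Algebra Γ(Spec (CommRingCat.of A), ⊤) Γ(Spec (CommRingCat.of Ap), ⊤) := (jl.appLE ⊤ ⊤ le_top).hom.toAlgebra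
  letI algK : Algebra Γ(Spec (CommRingCat.of A), ⊤) Γ(Spec (CommRingCat.of K), ⊤) := (jK.appLE ⊤ ⊤ le_top).hom.toAlgebra
  letI algψ : Algebra Γ(Spec (CommRingCat.of Ap), ⊤) Γ(Spec (CommRingCat.of K), ⊤) := (jψ.appLE ⊤ ⊤ le_top).hom.toAlgebra
  haveI : IsScalarTower Γ(Spec (CommRingCat.of A), ⊤) Γ(Spec (CommRingCat.of Ap), ⊤) Γ(Spec (CommRingCat.of K), ⊤) :=
    IsScalarTower.of_algebraMap_eq fun r => by
      change (jK.appLE ⊤ ⊤ le_top).hom r = (jψ.appLE ⊤ ⊤ le_top).hom ((jl.appLE ⊤ ⊤ le_top).hom r)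
      rw [appLE_SpecMap_apply, appLE_SpecMap_apply, appLE_SpecMap_apply, Iso.inv_hom_id_apply, hψ]
  change Module.finrank Γ(Spec (CommRingCat.of 𝔭.ResidueField), ⊤)
      (SecMod ((Scheme.Modules.pullback iX).obj G) f₀.appTop.hom ⊤) =
    Module.finrank Γ(Spec (CommRingCat.of K), ⊤)
      (Γ(Spec (CommRingCat.of K), ⊤) ⊗[Γ(Spec (CommRingCat.of A), ⊤)] SecMod G f.appTop.hom ⊤)
  -- the `A_𝔭`-module `A_𝔭 ⊗ Γ(X, G)` is finite free of rank `h⁰(X_𝔭, G_𝔭)`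
  obtain ⟨hfin, hproj⟩ := finite_and_projective_tensor_secMod_top_atPrime f G hL 𝔭 HX hvan
  haveI : IsLocalRing Γ(Spec (CommRingCat.of Ap), ⊤) := isLocalRing_Γ_Spec Ap
  have hflatN : Module.Flat Γ(Spec (CommRingCat.of Ap), ⊤)
      (Γ(Spec (CommRingCat.of Ap), ⊤) ⊗[Γ(Spec (CommRingCat.of A), ⊤)] SecMod G f.appTop.hom ⊤) :=
    @Module.Flat.of_projective _ _ _ _ _ hproj
  haveI : Module.Free Γ(Spec (CommRingCat.of Ap), ⊤)
      (Γ(Spec (CommRingCat.of Ap), ⊤) ⊗[Γ(Spec (CommRingCat.of A), ⊤)] SecMod G f.appTop.hom ⊤) :=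
    @Module.free_of_flat_of_isLocalRing _ _ _ _ _ _ hfin hflatN
  rw [← finrank_tensor_secMod_top_atPrime f G hL 𝔭 HX hvan]
  change Module.finrank Γ(Spec (CommRingCat.of Ap), ⊤)
      (Γ(Spec (CommRingCat.of Ap), ⊤) ⊗[Γ(Spec (CommRingCat.of A), ⊤)] SecMod G f.appTop.hom ⊤) = _
  -- and a free module keeps its rank under the base change `A_𝔭 → K`
  haveI : Nontrivial Γ(Spec (CommRingCat.of K), ⊤) :=
    (Scheme.ΓSpecIso (CommRingCat.of K)).commRingCatIsoToRingEquiv.toEquiv.nontrivial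
  have key : Module.finrank Γ(Spec (CommRingCat.of K), ⊤) (Γ(Spec (CommRingCat.of K), ⊤) ⊗[Γ(Spec (CommRingCat.of Ap), ⊤)]
      (Γ(Spec (CommRingCat.of Ap), ⊤) ⊗[Γ(Spec (CommRingCat.of A), ⊤)] SecMod G f.appTop.hom ⊤)) =
      Module.finrank Γ(Spec (CommRingCat.of Ap), ⊤)
        (Γ(Spec (CommRingCat.of Ap), ⊤) ⊗[Γ(Spec (CommRingCat.of A), ⊤)] SecMod G f.appTop.hom ⊤) :=
    Module.finrank_baseChange
  rw [← key]
  exact LinearEquiv.finrank_eq (TensorProduct.AlgebraTensorModule.cancelBaseChange Γ(Spec (CommRingCat.of A), ⊤)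
    Γ(Spec (CommRingCat.of Ap), ⊤) Γ(Spec (CommRingCat.of K), ⊤) Γ(Spec (CommRingCat.of K), ⊤) (SecMod G f.appTop.hom ⊤))

/-- **The fibre `h⁰` is the same at all primes where `H¹` vanishes, over an INTEGRAL base** (Hartshorne III Thm. 9.9 «the Hilbert
polynomial `P_t` is independent of `t`», in degree-`0` sections form; III Cor. 12.9): for `f : X → Spec A` proper flat over a Noetherian
domain, `G` finite locally free, and fibre squares at primes `𝔭`, `𝔮` with `Ext¹ = 0` on both fibres,
`h⁰(X_𝔭, G|_{X_𝔭}) = h⁰(X_𝔮, G|_{X_𝔮})` — both equal the generic rank of `Γ(X, G)`.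
[cite: Hartshorne1977, III Thm. 9.9 (p. 261)] [cite: Hartshorne1977, III Thm. 12.11 (p. 290), Cor. 12.9] [cite: MumfordAV1970, §5 Cor. 2 (p. 50)] -/
theorem finrank_secMod_fibre_eq_of_subsingleton_ext (hL : IsFiniteLocallyFree G) (𝔭 𝔮 : Ideal A) [𝔭.IsPrime] [𝔮.IsPrime]
    {X₁ : Scheme.{0}} {i₁ : X₁ ⟶ X} {f₁ : X₁ ⟶ Spec (CommRingCat.of 𝔭.ResidueField)}
    (H₁ : IsPullback i₁ f₁ f (Spec.map (CommRingCat.ofHom (algebraMap A 𝔭.ResidueField))))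
    (hvan₁ : Subsingleton (Ext.{1} (unitModule X₁) ((Scheme.Modules.pullback i₁).obj G) 1))
    {X₂ : Scheme.{0}} {i₂ : X₂ ⟶ X} {f₂ : X₂ ⟶ Spec (CommRingCat.of 𝔮.ResidueField)}
    (H₂ : IsPullback i₂ f₂ f (Spec.map (CommRingCat.ofHom (algebraMap A 𝔮.ResidueField))))
    (hvan₂ : Subsingleton (Ext.{1} (unitModule X₂) ((Scheme.Modules.pullback i₂).obj G) 1)) :
    Module.finrank Γ(Spec (CommRingCat.of 𝔭.ResidueField), ⊤) (SecMod ((Scheme.Modules.pullback i₁).obj G) f₁.appTop.hom ⊤) =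
      Module.finrank Γ(Spec (CommRingCat.of 𝔮.ResidueField), ⊤)
        (SecMod ((Scheme.Modules.pullback i₂).obj G) f₂.appTop.hom ⊤) := by
  have h₁ := finrank_secMod_fibre_eq_finrank_tensor_fractionRing f G hL 𝔭 H₁ hvan₁
  have h₂ := finrank_secMod_fibre_eq_finrank_tensor_fractionRing f G hL 𝔮 H₂ hvan₂
  exact h₁.trans h₂.symm

/-- **The fibre `h⁰` at a prime where `H¹` vanishes equals the GENERIC `h⁰`**: for ANY cartesian square `X_K = X ×_A K` over the
generic point `Spec K → Spec A` (`K = Frac A`), `h⁰(X_𝔭, G|_{X_𝔭}) = h⁰(X_K, G|_{X_K})` — no vanishing is needed on the generic fibre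
(flat base change of global sections, ★ `Modules.exists_tensor_secMod_top_linearEquiv_of_flat`, Stacks 02KH).
[cite: Hartshorne1977, III Thm. 9.9 (p. 261)] [cite: StacksProject, Tag 02KH] -/
theorem finrank_secMod_fibre_eq_finrank_secMod_genericFibre (hL : IsFiniteLocallyFree G) (𝔭 : Ideal A) [𝔭.IsPrime]
    {X₀ : Scheme.{0}} {iX : X₀ ⟶ X} {f₀ : X₀ ⟶ Spec (CommRingCat.of 𝔭.ResidueField)}
    (HX : IsPullback iX f₀ f (Spec.map (CommRingCat.ofHom (algebraMap A 𝔭.ResidueField))))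
    (hvan : Subsingleton (Ext.{1} (unitModule X₀) ((Scheme.Modules.pullback iX).obj G) 1))
    {XK : Scheme.{0}} {iK : XK ⟶ X} {fK : XK ⟶ Spec (CommRingCat.of (FractionRing A))}
    (HK : IsPullback iK fK f (Spec.map (CommRingCat.ofHom (algebraMap A (FractionRing A))))) :
    Module.finrank Γ(Spec (CommRingCat.of 𝔭.ResidueField), ⊤) (SecMod ((Scheme.Modules.pullback iX).obj G) f₀.appTop.hom ⊤) =
      Module.finrank Γ(Spec (CommRingCat.of (FractionRing A)), ⊤)
        (SecMod ((Scheme.Modules.pullback iK).obj G) fK.appTop.hom ⊤) := by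
  let K : Type := FractionRing A
  let jK : Spec (CommRingCat.of K) ⟶ Spec (CommRingCat.of A) := Spec.map (CommRingCat.ofHom (algebraMap A K))
  letI algK : Algebra Γ(Spec (CommRingCat.of A), ⊤) Γ(Spec (CommRingCat.of K), ⊤) := (jK.appLE ⊤ ⊤ le_top).hom.toAlgebra
  rw [finrank_secMod_fibre_eq_finrank_tensor_fractionRing f G hL 𝔭 HX hvan]
  change Module.finrank Γ(Spec (CommRingCat.of K), ⊤)
      (Γ(Spec (CommRingCat.of K), ⊤) ⊗[Γ(Spec (CommRingCat.of A), ⊤)] SecMod G f.appTop.hom ⊤) = _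
  -- flat base change along `Spec K → Spec A`
  obtain ⟨ι, _, _, U, hcov, hUa⟩ := exists_finite_affine_cover_cechOpen f
  haveI := hL.isVectorBundle.1
  have hG : IsAffineLocalizing G := IsAffineLocalizing.of_isQuasicoherent G
  haveI : Flat jK := by
    change Flat (Spec.map (CommRingCat.ofHom (algebraMap A K)))
    rw [HasRingHomProperty.Spec_iff (P := @Flat)]
    change (algebraMap A K).Flat
    rw [RingHom.flat_algebraMap_iff]
    exact IsLocalization.flat K (nonZeroDivisors A)
  have hflat : (jK.appLE ⊤ ⊤ le_top).hom.Flat :=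
    HasRingHomProperty.appLE (P := @Flat) jK inferInstance ⟨⊤, isAffineOpen_top _⟩ ⟨⊤, isAffineOpen_top _⟩ le_top
  obtain ⟨E, -⟩ := exists_tensor_secMod_top_linearEquiv_of_flat HK U hcov hUa G hG hflat
  exact E.finrank_eq

end GenericRank

end Literature.AlgebraicGeometry.Morphisms

end
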